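import Summits.Ventures.Crystal3D.Theorems.StickyWulffConstantCoaxialWallLawDebtTwinRow
import Summits.Ventures.Crystal3D.Theorems.StickyWulffConstantCoaxialWallLawDebtFaultRow
import Summits.Ventures.Crystal3D.Theorems.StickyWulffConstantCoaxialWallLawVicinalReachCoreCapstone
import Summits.Ventures.Crystal3D.Theorems.StickyWulffConstantCoaxialWallLawEndRowDefs
import HarnessLib

/-!
# CAPSTONE with the weakest third debt: `CoaxialWallLaw` BY NAME ⇐ {E1, `StarPairFar`, the two census rows, R3}
# (crux `CoaxialWallLaw`, stmt-Ventures-19481, line `WallLedgerF`)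

HONEST FRAMING. Venture `Summits/Ventures/Crystal3D` (cell `crystal3d-full`), helper `--supports` the crux
`CoaxialWallLaw` of `route-Ventures-StickyWulffConstant` (REGISTERED line `WallLedgerF`).  LEAF capstone; book-keeping only;
F-C1 not moved; CONDITIONAL on named facts.  19481-p2's `coaxialWallLaw_of_endRows_split` (`…EndRowsSplitCapstone`) carries
Debt 3 as `CoaxialTwoSlabAdhesionIncoherent`; here it is replaced by the SMALLER reach debt
`CoaxialTwoSlabAdhesionReachIncoherentDeep` (`…VicinalReachCore`: deep offsets registered for EVERY admissible walker vertical —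
numerically 3 % of wall normals × six level-1/9 classes, kit j313441/j313786), the census rows discharging R1/R2 through
`coaxialTwoSlabAdhesionCoherentTwin_of_row` / `coaxialTwoSlabAdhesionCoherentFault_of_row` and monotonicity.

`coaxialWallLaw_of_endRows_reach : KissingGap δ → KissingClassification δ → E1(s₀) → StarPairFar → 0 < s_F ≤ 2√6 →
   EndRowTwinHalfTurn v1 s_F → EndRowTrans v1 s_F → CoaxialTwoSlabAdhesionReachIncoherentDeep → CoaxialWallLaw`.

OWED after this file, all BY NAME: `EndRowTwinHalfTurn WordVersion.v1 s_F`, `EndRowTrans WordVersion.v1 s_F` (the STEP-3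
certificate), R3 `CoaxialTwoSlabAdhesionReachIncoherentDeep`, E1, `StarPairFar`, `KissingGap δ`, `KissingClassification δ`.
WHAT THIS IS NOT: a proof of any of those; F-C1 not moved.
-/

noncomputable section

namespace Summit.Ventures.Crystal3D.Theorems

open Summit.Ventures.Crystal3D Finset
open scoped InnerProductSpace

open scoped Classical in
/-- **The crux BY NAME from E1, `StarPairFar`, the two census rows and the reach-registered deep debt R3.** -/
theorem coaxialWallLaw_of_endRows_reach {δ : ℝ} (hg : KissingGap δ) (hc : KissingClassification δ)
    {s₀ : EuclideanSpace ℝ (Fin 3)} (hs₀ : s₀ ∈ fccSlots)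
    (hcert : ExactOnly 0 (fccSlots.filter fun w => 0 < ⟪w, s₀⟫_ℝ)) (hSP : StarPairFar)
    {sF : ℝ} (hsF : 0 < sF) (hsF' : sF ≤ 2 * Real.sqrt 6)
    (hW : EndRowTwinHalfTurn WordVersion.v1 sF) (hT : EndRowTrans WordVersion.v1 sF)
    (h₃ : CoaxialTwoSlabAdhesionReachIncoherentDeep) :
    Summit.Ventures.Crystal3D.Theses.StickyWulffConstant.CoaxialWallLaw :=
  coaxialWallLaw_of_reachSplit hs₀ hcert hSP
    (coaxialTwoSlabAdhesionOn_mono (fun _ _ _ _ hT' => ⟨hT'.1.1, hT'.2⟩)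
      (coaxialTwoSlabAdhesionCoherentTwin_of_row hg hc hsF hsF' hW))
    (coaxialTwoSlabAdhesionOn_mono (fun _ _ _ _ hT' => ⟨⟨hT'.1.1.1, hT'.1.2⟩, hT'.2⟩)
      (coaxialTwoSlabAdhesionCoherentFault_of_row hg hc hsF hsF' hT))
    h₃

/-- The same from `P5Exhaustion` (E1 as the certified computation). -/
theorem coaxialWallLaw_of_endRows_reach_p5 {δ : ℝ} (hg : KissingGap δ) (hc : KissingClassification δ)
    (hE1 : P5Exhaustion) (hSP : StarPairFar)
    {sF : ℝ} (hsF : 0 < sF) (hsF' : sF ≤ 2 * Real.sqrt 6)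
    (hW : EndRowTwinHalfTurn WordVersion.v1 sF) (hT : EndRowTrans WordVersion.v1 sF)
    (h₃ : CoaxialTwoSlabAdhesionReachIncoherentDeep) :
    Summit.Ventures.Crystal3D.Theses.StickyWulffConstant.CoaxialWallLaw := by
  obtain ⟨s₀, hs₀, hcert⟩ := exactOnly_star_of_p5Exhaustion hE1
  exact coaxialWallLaw_of_endRows_reach hg hc hs₀ hcert hSP hsF hsF' hW hT h₃

end Summit.Ventures.Crystal3D.Theorems

end
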